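import Literature.Analysis.FluidPDE.SawtoothCascadeSmooth
import Literature.Analysis.FluidPDE.SawtoothCascadeSlotDamping
import Summits.AnomalousDissipation.AnomalousDissipation.Theorems.SawtoothPulseCascadeK1LocalisedCascadeSlotLemma

/-!
# K1loc, line `Spectral` / SeqCone — THE SLOT LEMMA FOR ALL MODES AND ON THE CASCADE'S HALF-SLOTS

Seventh S3b file of the prover lane (first: the all-modes form `sqrt_tsum_symbolEnergy_le` of the slot lemma
`…SlotLemma.sqrt_symbolEnergy_le` by Parseval summability; then) — on the crux `K1LocalisedCascade` (stmt-AnomalousDissipation-19491), route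
`SawtoothPulseCascade`: the instantiation of the slot lemma to the H and V
half-slots of the rounded-sawtooth pulse cascade `SawtoothCascade.CascadeParams.field`.  On the H half-slot
`[tStart j, tStart j + tHalf j]` the field IS the shear drift `ShearStage.drift 0 1 ⟨U_j⟩ (rateH_j t)`
(`field_eq_drift_of_mem_H`, from the tree's `field_eq_of_mem_H`), the accumulated shear
`Γ_j(t) = ∫_{tStart j}^t rateH_j` is smooth with `Γ_j' = rateH_j`, `0 ≤ Γ_j ≤ γ` and `Γ_j(tStart j + tHalf j) = γ`
(`hasDerivAt_strainH`, `contDiff_strainH`, `strainH_mem_Icc`, tree `integral_rateH`); hence for every classical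
cascade scalar `w` on the slot, every smooth cut-off `X(x₁)` to flat strips of `U_j` of slope `σ` up to `ε₁`
(`|X| ≤ 1`, `|X'| ≤ C₁`, `|X''| ≤ C₂`, `γε₁ ≤ 1`) and all weights `0 ≤ w ≤ 1` on `ℤ²`
(`sqrt_tsum_symbolEnergy_le_H`):

  `√(∑' w |𝓕(X(x₁)·(w(t₁) ∘ Φ_γ))|²) ≤ √(∑' w |𝓕(X(x₁)·w(t₀))|²) + E_j · ‖w(t₀)‖_{L²}`,
  `E_j = 2κ·tHalf j·C₂ + 4C₁√(κ·tHalf j/2) + √(γε₁(5 + 6C₁²κ·tHalf j))`,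

with `Φ_γ = shearMap 0 1 (amp ⟨U_j⟩ (−γ))` the full H half-pulse map (`x ↦ x + γU_j(x₁)e₀`), `t₀ = tStart j`,
`t₁ = t₀ + tHalf j`; and the V twin (`sqrt_tsum_symbolEnergy_le_V`, indices swapped, `rateV`, slot
`[tStart j + tHalf j, tStart (j+1)]`).  This is block S3b of the architecture note (evidence
`K1loc-architecture-findings-k1locp1.md`, F-b) in the form the per-phase bookkeeping consumes: the error is
(diffusion length / cut-off width) and its square plus the slope residual, uniformly in the frequency weights.
WHAT THIS IS NOT: no statement about the stub itself; the un-gauging of `Φ_γ` (two-branch step, landed S3a layer)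
and the per-phase symbol geometry are separate.
[cite: ElgindiLissMattingly2025, §1 and Rmk. 1.4 (the pulsed sawtooth shears; strain ∫φ = α per pulse)]
[cite: BedrossianCotiZelati2017, §2 (advection–diffusion by a shear in shear coordinates)] [problem: turb]
-/

-- `Summit.<Summit>.<Problem>`: single-conjunct summit, the duplicate namespace segment is deliberate.
set_option linter.dupNamespace false

noncomputable section

namespace Summit.AnomalousDissipation.AnomalousDissipation.Theorems.SawtoothPulseCascade.K1Slot

open MeasureTheory Set Filter Topology UnitAddTorus Function
open scoped ContDiff InnerProductSpace
open Literature.Analysis Literature.Analysis.FunctionSpaces Literature.Analysis.FunctionSpaces.Torus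
open Literature.Analysis.FluidPDE.ShearStage

-- BODY

open Literature.Analysis.FluidPDE.SawtoothCascade Literature.Analysis.FluidPDE.SawtoothCascade.CascadeParams

section AllModes

variable {i j : Fin 2}

/-- **THE SLOT LEMMA (all modes).**  Under the hypotheses of `sqrt_symbolEnergy_le`, for weights `0 ≤ w ≤ 1` on `ℤ²`:
`√(∑' k, w(k)|𝓕F(t₁)(k)|²) ≤ √(∑' k, w(k)|𝓕F(t₀)(k)|²) + (2κτC₂ + 4C₁√(κτ/2) + √(γε₁(5 + 6C₁²κτ)))·‖θ(t₀)‖`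
(the finite-mode statement and Parseval summability). [cite: BedrossianCotiZelati2017, §2] -/
theorem sqrt_tsum_symbolEnergy_le (hij : i ≠ j) (P Q X Xd : ShearProfile) (hQ : ∀ y, Q y = deriv P y)
    (hXd : ∀ y, Xd y = deriv X y) {Γ ρ : ℝ → ℝ} {t₀ t₁ κ γ σ ε₁ C₁ C₂ : ℝ} (ht : t₀ < t₁) (hκ : 0 ≤ κ)
    (hε₁ : 0 ≤ ε₁) (hγε : γ * ε₁ ≤ 1) (hX1 : ∀ y, |X y| ≤ 1) (hC₁ : ∀ y, |Xd y| ≤ C₁)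
    (hC₂ : ∀ y, |deriv Xd y| ≤ C₂) (hflat : ∀ y, X y ≠ 0 ∨ Xd y ≠ 0 → |Q y - σ| ≤ ε₁)
    {u : ℝ → UnitAddTorus (Fin 2) → EuclideanSpace ℝ (Fin 2)} {θ : ℝ → UnitAddTorus (Fin 2) → ℝ}
    (hθ : FluidPDE.Torus.IsClassicalScalarTransportOn (Icc t₀ t₁) κ u θ)
    (hu : ∀ t ∈ Icc t₀ t₁, u t = drift i j P (ρ t)) (hΓs : ContDiffOn ℝ ∞ Γ (Icc t₀ t₁))
    (hΓρ : ∀ t ∈ Icc t₀ t₁, HasDerivWithinAt Γ (ρ t) (Icc t₀ t₁) t) (hΓγ : ∀ t ∈ Icc t₀ t₁, |Γ t| ≤ γ)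
    {w : (Fin 2 → ℤ) → ℝ} (hw0 : ∀ k, 0 ≤ w k) (hw1 : ∀ k, w k ≤ 1) :
    Real.sqrt (∑' k, w k * ‖mFourierCoeff (fun x => ((X.onCircle (x j) * moved θ i j P (-Γ) t₁ x : ℝ) : ℂ)) k‖ ^ 2)
      ≤ Real.sqrt (∑' k, w k *
          ‖mFourierCoeff (fun x => ((X.onCircle (x j) * moved θ i j P (-Γ) t₀ x : ℝ) : ℂ)) k‖ ^ 2) +
        (2 * κ * (t₁ - t₀) * C₂ + 4 * C₁ * Real.sqrt (κ * (t₁ - t₀) / 2) +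
          Real.sqrt (γ * ε₁ * (5 + 6 * C₁ ^ 2 * κ * (t₁ - t₀)))) * Real.sqrt (FluidPDE.Torus.scalarL2Sq (θ t₀)) := by
  -- summability of the weighted energies at any time of the slot (Parseval)
  have hG : IsSmoothSpaceTimeOn (Icc t₀ t₁) (moved θ i j P (-Γ)) :=
    isSmoothSpaceTimeOn_moved_of_contDiffOn i j P hΓs hθ.smooth_scalar
  have hsumm : ∀ t ∈ Icc t₀ t₁, Summable fun k => w k *
      ‖mFourierCoeff (fun x => ((X.onCircle (x j) * moved θ i j P (-Γ) t x : ℝ) : ℂ)) k‖ ^ 2 := by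
    intro t htI
    have hFt : IsSmooth (fun x => X.onCircle (x j) * moved θ i j P (-Γ) t x) :=
      (isSmooth_onCircle_comp' X j).mul (hG.isSmooth_slice htI)
    have hpar := hasSum_sq_mFourierCoeff_of_continuous (hFt.ofReal_comp).continuous
    refine hpar.summable.of_nonneg_of_le (fun k => mul_nonneg (hw0 k) (sq_nonneg _)) fun k => ?_
    calc w k * ‖mFourierCoeff (fun x => ((X.onCircle (x j) * moved θ i j P (-Γ) t x : ℝ) : ℂ)) k‖ ^ 2
        ≤ 1 * ‖mFourierCoeff (fun x => ((X.onCircle (x j) * moved θ i j P (-Γ) t x : ℝ) : ℂ)) k‖ ^ 2 :=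
          mul_le_mul_of_nonneg_right (hw1 k) (sq_nonneg _)
      _ = _ := one_mul _
  have h0 := hsumm t₀ (left_mem_Icc.2 ht.le)
  have h1 := hsumm t₁ (right_mem_Icc.2 ht.le)
  set E := (2 * κ * (t₁ - t₀) * C₂ + 4 * C₁ * Real.sqrt (κ * (t₁ - t₀) / 2) +
    Real.sqrt (γ * ε₁ * (5 + 6 * C₁ ^ 2 * κ * (t₁ - t₀)))) * Real.sqrt (FluidPDE.Torus.scalarL2Sq (θ t₀)) with hE
  have hC₁0 : 0 ≤ C₁ := (abs_nonneg _).trans (hC₁ 0)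
  have hC₂0 : 0 ≤ C₂ := (abs_nonneg _).trans (hC₂ 0)
  have hτ0 : 0 ≤ t₁ - t₀ := by linarith
  have hE0 : 0 ≤ E := by rw [hE]; positivity
  set B := Real.sqrt (∑' k, w k *
    ‖mFourierCoeff (fun x => ((X.onCircle (x j) * moved θ i j P (-Γ) t₀ x : ℝ) : ℂ)) k‖ ^ 2) + E with hB
  have hB0 : 0 ≤ B := add_nonneg (Real.sqrt_nonneg _) hE0
  have hfin : ∀ S : Finset (Fin 2 → ℤ), ∑ k ∈ S, w k *
      ‖mFourierCoeff (fun x => ((X.onCircle (x j) * moved θ i j P (-Γ) t₁ x : ℝ) : ℂ)) k‖ ^ 2 ≤ B ^ 2 := by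
    intro S
    have hS := sqrt_symbolEnergy_le hij P Q X Xd hQ hXd ht hκ hε₁ hγε hX1 hC₁ hC₂ hflat hθ hu hΓs hΓρ hΓγ S hw0 hw1
    have hS0 : ∑ k ∈ S, w k *
        ‖mFourierCoeff (fun x => ((X.onCircle (x j) * moved θ i j P (-Γ) t₀ x : ℝ) : ℂ)) k‖ ^ 2 ≤
        ∑' k, w k * ‖mFourierCoeff (fun x => ((X.onCircle (x j) * moved θ i j P (-Γ) t₀ x : ℝ) : ℂ)) k‖ ^ 2 :=
      h0.sum_le_tsum S fun k _ => mul_nonneg (hw0 k) (sq_nonneg _)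
    have hle : Real.sqrt (∑ k ∈ S, w k *
        ‖mFourierCoeff (fun x => ((X.onCircle (x j) * moved θ i j P (-Γ) t₁ x : ℝ) : ℂ)) k‖ ^ 2) ≤ B := by
      rw [hB, hE]
      exact hS.trans (add_le_add_left (Real.sqrt_le_sqrt hS0) _)
    have hnn : 0 ≤ ∑ k ∈ S, w k *
        ‖mFourierCoeff (fun x => ((X.onCircle (x j) * moved θ i j P (-Γ) t₁ x : ℝ) : ℂ)) k‖ ^ 2 :=
      Finset.sum_nonneg fun k _ => mul_nonneg (hw0 k) (sq_nonneg _)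
    calc _ = Real.sqrt (∑ k ∈ S, w k *
          ‖mFourierCoeff (fun x => ((X.onCircle (x j) * moved θ i j P (-Γ) t₁ x : ℝ) : ℂ)) k‖ ^ 2) ^ 2 :=
          (Real.sq_sqrt hnn).symm
      _ ≤ B ^ 2 := pow_le_pow_left₀ (Real.sqrt_nonneg _) hle 2
  have htsum := h1.tsum_le_of_sum_le hfin
  calc Real.sqrt (∑' k, w k *
        ‖mFourierCoeff (fun x => ((X.onCircle (x j) * moved θ i j P (-Γ) t₁ x : ℝ) : ℂ)) k‖ ^ 2)
      ≤ Real.sqrt (B ^ 2) := Real.sqrt_le_sqrt htsum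
    _ = B := Real.sqrt_sq hB0
    _ = _ := by rw [hB, hE]

end AllModes

section Cascade

variable (P : CascadeParams)

/-! ## The H half-slot: the field is a shear drift, the strain clock -/

/-- On the H half-slot of phase `j` the cascade field is the 2D shear drift `ShearStage.drift 0 1 ⟨U_j⟩ (rateH_j t)`.
[cite: ElgindiLissMattingly2025, §1 (u_α = H_α on its half period)] -/
theorem field_eq_drift_of_mem_H {j : ℕ} (hδ : 0 < P.δ j) {t : ℝ} (ht : t ∈ Icc (tStart j) (tStart j + tHalf j)) :
    P.field t = drift 0 1 ⟨P.U j, P.U_periodic j, P.contDiff_U hδ⟩ (P.rateH j t) := by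
  funext x
  rw [P.field_eq_of_mem_H ht x, drift_apply]
  have hx : ((Torus.repr x 1 : ℝ) : UnitAddCircle) = x 1 := by
    have h := congrFun (Torus.proj_repr x) 1
    rwa [Torus.proj_apply] at h
  rw [← hx, ShearProfile.onCircle_coe]
  ext l
  fin_cases l <;> simp

/-- On the V half-slot of phase `j` the cascade field is the 2D shear drift `ShearStage.drift 1 0 ⟨U_j⟩ (rateV_j t)`.
[cite: ElgindiLissMattingly2025, §1 (u_α = V_α on its half period)] -/
theorem field_eq_drift_of_mem_V {j : ℕ} (hδ : 0 < P.δ j) {t : ℝ} (ht : t ∈ Icc (tStart j + tHalf j) (tStart (j + 1))) :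
    P.field t = drift 1 0 ⟨P.U j, P.U_periodic j, P.contDiff_U hδ⟩ (P.rateV j t) := by
  funext x
  rw [P.field_eq_of_mem_V ht x, drift_apply]
  have hx : ((Torus.repr x 0 : ℝ) : UnitAddCircle) = x 0 := by
    have h := congrFun (Torus.proj_repr x) 0
    rwa [Torus.proj_apply] at h
  rw [← hx, ShearProfile.onCircle_coe]
  ext l
  fin_cases l <;> simp

/-- The accumulated H strain `Γ_j(t) = ∫_{tStart j}^t rateH_j` has derivative `rateH_j t` everywhere.
[cite: ElgindiLissMattingly2025, Rmk. 1.4 (∫φ = α)] -/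
theorem hasDerivAt_strainH (j : ℕ) (t : ℝ) :
    HasDerivAt (fun t => ∫ s in tStart j..t, P.rateH j s) (P.rateH j t) t :=
  intervalIntegral.integral_hasDerivAt_right ((P.continuous_rateH j).intervalIntegrable _ _)
    ((P.continuous_rateH j).stronglyMeasurableAtFilter _ _) (P.continuous_rateH j).continuousAt

/-- The accumulated H strain is smooth. [cite: ElgindiLissMattingly2025, Rmk. 1.4 (smooth-in-time pulses)] -/
theorem contDiff_strainH (j : ℕ) : ContDiff ℝ ∞ (fun t => ∫ s in tStart j..t, P.rateH j s) := by
  rw [contDiff_infty_iff_deriv]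
  refine ⟨fun t => (hasDerivAt_strainH P j t).differentiableAt, ?_⟩
  have h : deriv (fun t => ∫ s in tStart j..t, P.rateH j s) = P.rateH j := funext fun t => (hasDerivAt_strainH P j t).deriv
  rw [h]
  exact P.contDiff_rateH j

/-- On the H half-slot, `0 ≤ Γ_j(t) ≤ γ` (`rateH ≥ 0`, total strain `γ`). [cite: ElgindiLissMattingly2025, Rmk. 1.4] -/
theorem strainH_mem_Icc (hγ : 0 ≤ P.γ) {j : ℕ} {t : ℝ} (ht : t ∈ Icc (tStart j) (tStart j + tHalf j)) :
    (∫ s in tStart j..t, P.rateH j s) ∈ Icc 0 P.γ :=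
  ⟨intervalIntegral.integral_nonneg ht.1 fun s _ => P.rateH_nonneg hγ j s, P.integral_rateH_le hγ ht⟩

/-- The accumulated V strain `∫_{tStart j + tHalf j}^t rateV_j` has derivative `rateV_j t` everywhere.
[cite: ElgindiLissMattingly2025, Rmk. 1.4 (∫φ = α)] -/
theorem hasDerivAt_strainV (j : ℕ) (t : ℝ) :
    HasDerivAt (fun t => ∫ s in (tStart j + tHalf j)..t, P.rateV j s) (P.rateV j t) t :=
  intervalIntegral.integral_hasDerivAt_right ((P.continuous_rateV j).intervalIntegrable _ _)
    ((P.continuous_rateV j).stronglyMeasurableAtFilter _ _) (P.continuous_rateV j).continuousAt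

/-- The accumulated V strain is smooth. [cite: ElgindiLissMattingly2025, Rmk. 1.4 (smooth-in-time pulses)] -/
theorem contDiff_strainV (j : ℕ) : ContDiff ℝ ∞ (fun t => ∫ s in (tStart j + tHalf j)..t, P.rateV j s) := by
  rw [contDiff_infty_iff_deriv]
  refine ⟨fun t => (hasDerivAt_strainV P j t).differentiableAt, ?_⟩
  have h : deriv (fun t => ∫ s in (tStart j + tHalf j)..t, P.rateV j s) = P.rateV j :=
    funext fun t => (hasDerivAt_strainV P j t).deriv
  rw [h]
  exact P.contDiff_rateV j

/-- On the V half-slot, `0 ≤ ∫ rateV ≤ γ`. [cite: ElgindiLissMattingly2025, Rmk. 1.4] -/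
theorem strainV_mem_Icc (hγ : 0 ≤ P.γ) {j : ℕ} {t : ℝ} (ht : t ∈ Icc (tStart j + tHalf j) (tStart (j + 1))) :
    (∫ s in (tStart j + tHalf j)..t, P.rateV j s) ∈ Icc 0 P.γ :=
  ⟨intervalIntegral.integral_nonneg ht.1 fun s _ => P.rateV_nonneg hγ j s, P.integral_rateV_le hγ ht⟩

/-! ## The slot lemma on the H and V half-slots of the cascade -/

/-- **The slot lemma on the H half-slot of phase `j` of the cascade.**  For a classical solution `w` of
`∂ₜw + ū·∇w = κΔw` on `[tStart j, tStart j + tHalf j]` (`ū = CascadeParams.field`, `γ ≥ 0`, `δ_j > 0`), a cut-off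
profile `X` (`Xd = X'`, `|X| ≤ 1`, `|X'| ≤ C₁`, `|X''| ≤ C₂`) to strips of `x₁` on which `|U_j' − σ| ≤ ε₁`
(`Q = U_j'`), `γε₁ ≤ 1`, and weights `0 ≤ w ≤ 1` on `ℤ²`: the weighted spectral energy of the localised
pull-back `X(x₁)·(w(t₁) ∘ Φ_γ)`, `Φ_γ = x ↦ x + γU_j(x₁)e₀`, `t₁ = tStart j + tHalf j`, exceeds that of
`X(x₁)·w(tStart j)` by at most `(2κ·tHalf j·C₂ + 4C₁√(κ·tHalf j/2) + √(γε₁(5 + 6C₁²κ·tHalf j)))·‖w(tStart j)‖`.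
[cite: BedrossianCotiZelati2017, §2 (energy method in shear coordinates)] -/
theorem sqrt_tsum_symbolEnergy_le_H (hγ : 0 ≤ P.γ) {j : ℕ} (hδ : 0 < P.δ j) (Q X Xd : ShearProfile)
    (hQ : ∀ y, Q y = deriv (P.U j) y) (hXd : ∀ y, Xd y = deriv X y) {κ σ ε₁ C₁ C₂ : ℝ} (hκ : 0 ≤ κ)
    (hε₁ : 0 ≤ ε₁) (hγε : P.γ * ε₁ ≤ 1) (hX1 : ∀ y, |X y| ≤ 1) (hC₁ : ∀ y, |Xd y| ≤ C₁)
    (hC₂ : ∀ y, |deriv Xd y| ≤ C₂) (hflat : ∀ y, X y ≠ 0 ∨ Xd y ≠ 0 → |Q y - σ| ≤ ε₁)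
    {w : ℝ → UnitAddTorus (Fin 2) → ℝ}
    (hw : FluidPDE.Torus.IsClassicalScalarTransportOn (Icc (tStart j) (tStart j + tHalf j)) κ P.field w)
    {wt : (Fin 2 → ℤ) → ℝ} (hw0 : ∀ k, 0 ≤ wt k) (hw1 : ∀ k, wt k ≤ 1) :
    Real.sqrt (∑' k, wt k * ‖mFourierCoeff (fun x => ((X.onCircle (x 1) *
        w (tStart j + tHalf j) (shearMap 0 1 (amp ⟨P.U j, P.U_periodic j, P.contDiff_U hδ⟩ (-P.γ)) x) : ℝ) : ℂ)) k‖ ^ 2)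
      ≤ Real.sqrt (∑' k, wt k * ‖mFourierCoeff (fun x => ((X.onCircle (x 1) * w (tStart j) x : ℝ) : ℂ)) k‖ ^ 2) +
        (2 * κ * tHalf j * C₂ + 4 * C₁ * Real.sqrt (κ * tHalf j / 2) +
          Real.sqrt (P.γ * ε₁ * (5 + 6 * C₁ ^ 2 * κ * tHalf j))) *
          Real.sqrt (FluidPDE.Torus.scalarL2Sq (w (tStart j))) := by
  set U : ShearProfile := ⟨P.U j, P.U_periodic j, P.contDiff_U hδ⟩ with hU
  set Γ : ℝ → ℝ := fun t => ∫ s in tStart j..t, P.rateH j s with hΓ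
  have ht : tStart j < tStart j + tHalf j := by linarith [tHalf_pos j]
  have hQ' : ∀ y, Q y = deriv U y := hQ
  have hmain := sqrt_tsum_symbolEnergy_le (i := 0) (j := 1) (by decide) U Q X Xd hQ' hXd (Γ := Γ)
    (ρ := P.rateH j) (σ := σ) ht hκ hε₁ hγε hX1 hC₁ hC₂ hflat hw
    (fun t htI => field_eq_drift_of_mem_H P hδ htI) ((contDiff_strainH P j).contDiffOn)
    (fun t _ => (hasDerivAt_strainH P j t).hasDerivWithinAt)
    (fun t htI => by
      have h := strainH_mem_Icc P hγ htI
      rw [abs_of_nonneg h.1]; exact h.2) hw0 hw1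
  -- identify the two pull-backs: `Γ(tStart j) = 0`, `Γ(tStart j + tHalf j) = γ`
  have hΓ0 : Γ (tStart j) = 0 := by simp [hΓ]
  have hΓ1 : Γ (tStart j + tHalf j) = P.γ := by simp only [hΓ]; exact P.integral_rateH j
  have e0 : (fun x => ((X.onCircle (x 1) * moved w 0 1 U (-Γ) (tStart j) x : ℝ) : ℂ)) =
      fun x => ((X.onCircle (x 1) * w (tStart j) x : ℝ) : ℂ) := by
    funext x; rw [moved_apply, Pi.neg_apply, hΓ0, neg_zero, shearMap_amp_zero]
  have e1 : (fun x => ((X.onCircle (x 1) * moved w 0 1 U (-Γ) (tStart j + tHalf j) x : ℝ) : ℂ)) =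
      fun x => ((X.onCircle (x 1) * w (tStart j + tHalf j) (shearMap 0 1 (amp U (-P.γ)) x) : ℝ) : ℂ) := by
    funext x; rw [moved_apply, Pi.neg_apply, hΓ1]
  rw [e0, e1, add_sub_cancel_left] at hmain
  exact hmain

/-- **The slot lemma on the V half-slot of phase `j` of the cascade** (indices swapped: the cut-off reads `x₀`, the
pull-back is by `x ↦ x + γU_j(x₀)e₁`, `t₀ = tStart j + tHalf j`, `t₁ = tStart (j+1)`).
[cite: BedrossianCotiZelati2017, §2 (energy method in shear coordinates)] -/
theorem sqrt_tsum_symbolEnergy_le_V (hγ : 0 ≤ P.γ) {j : ℕ} (hδ : 0 < P.δ j) (Q X Xd : ShearProfile)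
    (hQ : ∀ y, Q y = deriv (P.U j) y) (hXd : ∀ y, Xd y = deriv X y) {κ σ ε₁ C₁ C₂ : ℝ} (hκ : 0 ≤ κ)
    (hε₁ : 0 ≤ ε₁) (hγε : P.γ * ε₁ ≤ 1) (hX1 : ∀ y, |X y| ≤ 1) (hC₁ : ∀ y, |Xd y| ≤ C₁)
    (hC₂ : ∀ y, |deriv Xd y| ≤ C₂) (hflat : ∀ y, X y ≠ 0 ∨ Xd y ≠ 0 → |Q y - σ| ≤ ε₁)
    {w : ℝ → UnitAddTorus (Fin 2) → ℝ}
    (hw : FluidPDE.Torus.IsClassicalScalarTransportOn (Icc (tStart j + tHalf j) (tStart (j + 1))) κ P.field w)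
    {wt : (Fin 2 → ℤ) → ℝ} (hw0 : ∀ k, 0 ≤ wt k) (hw1 : ∀ k, wt k ≤ 1) :
    Real.sqrt (∑' k, wt k * ‖mFourierCoeff (fun x => ((X.onCircle (x 0) *
        w (tStart (j + 1)) (shearMap 1 0 (amp ⟨P.U j, P.U_periodic j, P.contDiff_U hδ⟩ (-P.γ)) x) : ℝ) : ℂ)) k‖ ^ 2)
      ≤ Real.sqrt (∑' k, wt k * ‖mFourierCoeff (fun x => ((X.onCircle (x 0) * w (tStart j + tHalf j) x : ℝ) : ℂ)) k‖ ^ 2)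
        + (2 * κ * tHalf j * C₂ + 4 * C₁ * Real.sqrt (κ * tHalf j / 2) +
          Real.sqrt (P.γ * ε₁ * (5 + 6 * C₁ ^ 2 * κ * tHalf j))) *
          Real.sqrt (FluidPDE.Torus.scalarL2Sq (w (tStart j + tHalf j))) := by
  set U : ShearProfile := ⟨P.U j, P.U_periodic j, P.contDiff_U hδ⟩ with hU
  set Γ : ℝ → ℝ := fun t => ∫ s in (tStart j + tHalf j)..t, P.rateV j s with hΓ
  have ht : tStart j + tHalf j < tStart (j + 1) := by rw [tStart_succ]; linarith [tHalf_pos j]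
  have hτ : tStart (j + 1) - (tStart j + tHalf j) = tHalf j := by rw [tStart_succ]; ring
  have hQ' : ∀ y, Q y = deriv U y := hQ
  have hmain := sqrt_tsum_symbolEnergy_le (i := 1) (j := 0) (by decide) U Q X Xd hQ' hXd (Γ := Γ)
    (ρ := P.rateV j) (σ := σ) ht hκ hε₁ hγε hX1 hC₁ hC₂ hflat hw
    (fun t htI => field_eq_drift_of_mem_V P hδ htI) ((contDiff_strainV P j).contDiffOn)
    (fun t _ => (hasDerivAt_strainV P j t).hasDerivWithinAt)
    (fun t htI => by
      have h := strainV_mem_Icc P hγ htI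
      rw [abs_of_nonneg h.1]; exact h.2) hw0 hw1
  have hΓ0 : Γ (tStart j + tHalf j) = 0 := by simp [hΓ]
  have hΓ1 : Γ (tStart (j + 1)) = P.γ := by simp only [hΓ]; exact P.integral_rateV j
  have e0 : (fun x => ((X.onCircle (x 0) * moved w 1 0 U (-Γ) (tStart j + tHalf j) x : ℝ) : ℂ)) =
      fun x => ((X.onCircle (x 0) * w (tStart j + tHalf j) x : ℝ) : ℂ) := by
    funext x; rw [moved_apply, Pi.neg_apply, hΓ0, neg_zero, shearMap_amp_zero]
  have e1 : (fun x => ((X.onCircle (x 0) * moved w 1 0 U (-Γ) (tStart (j + 1)) x : ℝ) : ℂ)) =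
      fun x => ((X.onCircle (x 0) * w (tStart (j + 1)) (shearMap 1 0 (amp U (-P.γ)) x) : ℝ) : ℂ) := by
    funext x; rw [moved_apply, Pi.neg_apply, hΓ1]
  rw [e0, e1, hτ] at hmain
  exact hmain


/-! ## Glue to the stub's hypothesis class: classical cascade scalars on `[0,1)` -/

/-- **The H-slot lemma for classical cascade scalars on `[0,1)`** (the stub's hypothesis class
`IsClassicalScalarTransportOn (Ico 0 1) κ P.field w`, with `γ ≥ 0`, `δ₀ > 0`, `d > 0`): restriction to the closed H
half-slot of phase `j` and `sqrt_tsum_symbolEnergy_le_H`. [cite: BedrossianCotiZelati2017, §2] -/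
theorem sqrt_tsum_symbolEnergy_le_H_of_Ico (hγ : 0 ≤ P.γ) (hδ₀ : 0 < P.δ₀) (hd : 0 < P.d) (j : ℕ)
    (Q X Xd : ShearProfile) (hQ : ∀ y, Q y = deriv (P.U j) y) (hXd : ∀ y, Xd y = deriv X y) {κ σ ε₁ C₁ C₂ : ℝ}
    (hκ : 0 ≤ κ) (hε₁ : 0 ≤ ε₁) (hγε : P.γ * ε₁ ≤ 1) (hX1 : ∀ y, |X y| ≤ 1) (hC₁ : ∀ y, |Xd y| ≤ C₁)
    (hC₂ : ∀ y, |deriv Xd y| ≤ C₂) (hflat : ∀ y, X y ≠ 0 ∨ Xd y ≠ 0 → |Q y - σ| ≤ ε₁)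
    {w : ℝ → UnitAddTorus (Fin 2) → ℝ} (hw : FluidPDE.Torus.IsClassicalScalarTransportOn (Ico 0 1) κ P.field w)
    {wt : (Fin 2 → ℤ) → ℝ} (hw0 : ∀ k, 0 ≤ wt k) (hw1 : ∀ k, wt k ≤ 1) :
    Real.sqrt (∑' k, wt k * ‖mFourierCoeff (fun x => ((X.onCircle (x 1) * w (tStart j + tHalf j)
        (shearMap 0 1 (amp ⟨P.U j, P.U_periodic j, P.contDiff_U (P.δ_pos hδ₀ hd j)⟩ (-P.γ)) x) : ℝ) : ℂ)) k‖ ^ 2)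
      ≤ Real.sqrt (∑' k, wt k * ‖mFourierCoeff (fun x => ((X.onCircle (x 1) * w (tStart j) x : ℝ) : ℂ)) k‖ ^ 2) +
        (2 * κ * tHalf j * C₂ + 4 * C₁ * Real.sqrt (κ * tHalf j / 2) +
          Real.sqrt (P.γ * ε₁ * (5 + 6 * C₁ ^ 2 * κ * tHalf j))) *
          Real.sqrt (FluidPDE.Torus.scalarL2Sq (w (tStart j))) :=
  sqrt_tsum_symbolEnergy_le_H P hγ (P.δ_pos hδ₀ hd j) Q X Xd hQ hXd hκ hε₁ hγε hX1 hC₁ hC₂ hflat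
    (hw.restrict_Icc (by linarith [tHalf_pos j]) (CascadeParams.Icc_H_subset_Ico j)) hw0 hw1

/-- **The V-slot lemma for classical cascade scalars on `[0,1)`**. [cite: BedrossianCotiZelati2017, §2] -/
theorem sqrt_tsum_symbolEnergy_le_V_of_Ico (hγ : 0 ≤ P.γ) (hδ₀ : 0 < P.δ₀) (hd : 0 < P.d) (j : ℕ)
    (Q X Xd : ShearProfile) (hQ : ∀ y, Q y = deriv (P.U j) y) (hXd : ∀ y, Xd y = deriv X y) {κ σ ε₁ C₁ C₂ : ℝ}
    (hκ : 0 ≤ κ) (hε₁ : 0 ≤ ε₁) (hγε : P.γ * ε₁ ≤ 1) (hX1 : ∀ y, |X y| ≤ 1) (hC₁ : ∀ y, |Xd y| ≤ C₁)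
    (hC₂ : ∀ y, |deriv Xd y| ≤ C₂) (hflat : ∀ y, X y ≠ 0 ∨ Xd y ≠ 0 → |Q y - σ| ≤ ε₁)
    {w : ℝ → UnitAddTorus (Fin 2) → ℝ} (hw : FluidPDE.Torus.IsClassicalScalarTransportOn (Ico 0 1) κ P.field w)
    {wt : (Fin 2 → ℤ) → ℝ} (hw0 : ∀ k, 0 ≤ wt k) (hw1 : ∀ k, wt k ≤ 1) :
    Real.sqrt (∑' k, wt k * ‖mFourierCoeff (fun x => ((X.onCircle (x 0) * w (tStart (j + 1))
        (shearMap 1 0 (amp ⟨P.U j, P.U_periodic j, P.contDiff_U (P.δ_pos hδ₀ hd j)⟩ (-P.γ)) x) : ℝ) : ℂ)) k‖ ^ 2)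
      ≤ Real.sqrt (∑' k, wt k * ‖mFourierCoeff (fun x => ((X.onCircle (x 0) * w (tStart j + tHalf j) x : ℝ) : ℂ)) k‖ ^ 2)
        + (2 * κ * tHalf j * C₂ + 4 * C₁ * Real.sqrt (κ * tHalf j / 2) +
          Real.sqrt (P.γ * ε₁ * (5 + 6 * C₁ ^ 2 * κ * tHalf j))) *
          Real.sqrt (FluidPDE.Torus.scalarL2Sq (w (tStart j + tHalf j))) :=
  sqrt_tsum_symbolEnergy_le_V P hγ (P.δ_pos hδ₀ hd j) Q X Xd hQ hXd hκ hε₁ hγε hX1 hC₁ hC₂ hflat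
    (hw.restrict_Icc (by rw [tStart_succ]; linarith [tHalf_pos j]) (CascadeParams.Icc_V_subset_Ico j)) hw0 hw1

end Cascade

end Summit.AnomalousDissipation.AnomalousDissipation.Theorems.SawtoothPulseCascade.K1Slot
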